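import Summits.HubbardSuperconductivity.HubbardSuperconductivity.Theorems.AnisotropyChordTransferFibre3FinXBCover

/-!
# Route `AnisotropyChord` / H0 rotor rung: FIN exact-block row-`N₁` certificate at `L = 13` — cell facts, part `d`

Kernel facts `xbCellAny 13 (49/50) la lb c = true` (`decide +kernel`, zero data) for 7 λ-cells of the per-`L` cover
(`…FinXBCover.xbCheck`; cell design: p3 g5 scratch `xb_design.py`, float mirror `xb_mirror.py`); assembled in `…FinXBThirteen`.
Prover seat `hubbard-h0-rotor-p3` g5; helper for piece A = stmt-HubbardSuperconductivity-23918 of rung 19089 (`--supports`, helper class).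
WHAT THIS IS NOT: nothing here proves superconductivity in the Hubbard model (rotor TARGET as worded stays FALSE, g15 verdict); kernel facts for the FIN certificate of ONE hypothesis (row `N₁`) of ONE conditional reduction.  Tree imports only; no sorry, no new axioms.
-/

namespace Summit.HubbardSuperconductivity.HubbardSuperconductivity.Theorems.AnisotropyChord.Transfer.Fibre3

namespace FinXB

set_option maxHeartbeats 4000000 in
/-- kernel fact: cell 34 at `L = 13` (certified, c = (2/5 : ℚ)). [folklore] -/
theorem xb13_34 : xbCellAny 13 (49/50 : ℚ) 1166065761154843 1236029706824134 (2/5 : ℚ) = true := by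
  decide +kernel

set_option maxHeartbeats 4000000 in
/-- kernel fact: cell 35 at `L = 13` (certified, c = (2/5 : ℚ)). [folklore] -/
theorem xb13_35 : xbCellAny 13 (49/50 : ℚ) 1236029706824134 1310191489233583 (2/5 : ℚ) = true := by
  decide +kernel

set_option maxHeartbeats 4000000 in
/-- kernel fact: cell 36 at `L = 13` (certified, c = (2/5 : ℚ)). [folklore] -/
theorem xb13_36 : xbCellAny 13 (49/50 : ℚ) 1310191489233583 1388802978587599 (2/5 : ℚ) = true := by
  decide +kernel

set_option maxHeartbeats 4000000 in
/-- kernel fact: cell 37 at `L = 13` (certified, c = (2/5 : ℚ)). [folklore] -/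
theorem xb13_37 : xbCellAny 13 (49/50 : ℚ) 1388802978587599 1472131157302856 (2/5 : ℚ) = true := by
  decide +kernel

set_option maxHeartbeats 4000000 in
/-- kernel fact: cell 38 at `L = 13` (certified, c = (2/5 : ℚ)). [folklore] -/
theorem xb13_38 : xbCellAny 13 (49/50 : ℚ) 1472131157302856 1560459026741028 (2/5 : ℚ) = true := by
  decide +kernel

set_option maxHeartbeats 4000000 in
/-- kernel fact: cell 39 at `L = 13` (certified, c = (2/5 : ℚ)). [folklore] -/
theorem xb13_39 : xbCellAny 13 (49/50 : ℚ) 1560459026741028 1654086568345490 (2/5 : ℚ) = true := by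
  decide +kernel

set_option maxHeartbeats 4000000 in
/-- kernel fact: cell 40 at `L = 13` (certified, c = (9/20 : ℚ)). [folklore] -/
theorem xb13_40 : xbCellAny 13 (49/50 : ℚ) 1654086568345490 1753331762446220 (9/20 : ℚ) = true := by
  decide +kernel

end FinXB

end Summit.HubbardSuperconductivity.HubbardSuperconductivity.Theorems.AnisotropyChord.Transfer.Fibre3
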